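import Summits.QuantumFields.YangMills.Theses.LangevinControlUV
import Summits.QuantumFields.YangMills.Theorems.LatticeGapOnTrajectory.Negative.ZeroCouplingGap
import Literature.MathematicalPhysics.QuantumFieldTheory.MassGapFromLatticeClustering
import Literature.MathematicalPhysics.QuantumFieldTheory.OSDataSpeciesExtension

/-!
# Disproof of `GapToContinuum` (stmt-QuantumFields-8896) — findings of the standing disprover

Crux (shared by routes `LangevinControlUV` #9 and `OneCertifiedCube`):
`∀ G r sch T Δ, 0 < Δ → IsYangMillsFor r sch T → HasLatticeMassGap r sch Δ → T.HasMassGap Δ`.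

VERDICT OF CYCLE 1: **no kill; the crux resists every cheap attack, for an instructive reason** — every
lattice model on which the two hypotheses can be EVALUATED in the tree (trivial group, zero coupling) has
an ultralocal continuum limit on `⁰𝒮`, where the conclusion holds with constant `0`; every model where the
conclusion could fail (a gapless or under-gapped continuum limit of a Wilson theory) is one where neither
hypothesis can be certified today. What the attacks DO establish, kernel-checked:

* §1 `gapToContinuum_iff` — the reading (no simplicity of `G`, no `0 ≤ β_k`, no `HasWeakCouplingLimit`;
  `HasLatticeMassGap` is `∀ A B, ∃ C, ∀ᶠ k` — pair-dependent constant AND threshold; the conclusion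
  clusters ALL arities, all time-ordered Schwartz `F, G`).
* §2 JUNK AUDIT (positive, for the provers — not landed by me): `gapToContinuum_of_subsingleton` — at a
  trivial gauge group the conclusion `T.HasMassGap Δ` follows from `IsYangMillsFor` ALONE, for EVERY real
  `Δ` (the lattice `n`-point functions are deterministic products, so the tree's Cauchy–Schwarz transfer
  `IsYangMillsFor.hasMassGap_of_hasCSClustering` applies with clustered quantity `→ 0`); the hypotheses
  are junk-reachable (`hypotheses_junk_reachable`: `β ≡ 0` + vacuum datum, tree
  `hasLatticeMassGap_of_zero_coupling`). So NO degenerate instance refutes the crux, and `0 < Δ`,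
  `HasLatticeMassGap` are idle there.
* §3 LOAD-BEARING HYPOTHESES: `IsYangMillsFor` is load-bearing MODULO the existence of a one-field
  gapless OS datum on `ℝ⁴` (`gapToContinuum_false_without_isYangMillsFor_of_gapless`, LANDED p120966 as
  `Negative/WithoutIsYangMillsFor.lean`; `GaplessOSDatum` is
  true in mathematics — free field of mass `m < Δ` — but not constructible in the tree: free-field
  existence is the named fact `existsUnique_freeField`, its OS package is in measure form, and no LOWER
  clustering bound is held); `HasLatticeMassGap` is load-bearing modulo a gapless continuum limit of SOME
  Wilson lattice gauge theory (`GapToContinuumWithoutLatticeGap`, status note: research-level, e.g. the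
  free-photon scaling limit of compact `U(1)` in the Coulomb phase); `0 < Δ` is DECORATION (§3c note: for
  `Δ ≤ 0` the conclusion is the contraction bound of OS reconstruction, true for every OS datum).
* §4 NATURAL STRENGTHENING REFUTED (landed p120725,
  `Theorems/GapToContinuum/Negative/HeavyProductLeak.lean`, `not_heavyKetsProductClosed`): kets that
  cluster at rate `q` under a positive contraction transfer matrix are NOT closed under products /
  sandwiches by an observable (three-level witness) — the per-pair thresholds of `HasLatticeMassGap`
  control the `(1,1)` sector of `T.HasMassGap` only; multi-leg sectors need the thresholds of all product
  species `A·τ_z B` uniformly in `z` at each step, which `∀ A B ∃ C ∀ᶠ k` does not give. Together with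
  `LatticeGapOnTrajectory.Negative.perPair_clustering_does_not_transfer` (per-pair CONSTANTS do not pass
  to pointwise limits; evaded by RP on diagonal pairs) this prices the residual exactly: a PAIR-UNIFORM
  threshold (`∃ k₀ ∀ A B ∃ C ∀ k ≥ k₀`, the shape of stmt-16126 / `UniformLatticeGap`) or product-closure
  of the good class (a correlation inequality — abelian only).
* §5 THE β-SIGN HOLE (ideators F3/H1): `sch.β` is a free real sequence and odd-torus link reflection
  positivity needs `0 ≤ β`. Why it yields no cheap kill: for `G ∋ -1` (U(1), SU(2)) the staggering
  `U_e ↦ (-1)^{f(e)} U_e`, `f_ν(x) = Σ_{μ<ν} x_μ`, flips EVERY plaquette (`stagger_plaquette_odd`, all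
  dimensions) and is an exact symmetry `β ↔ -β` of Wilson's action on `ℤ^d` and even tori mapping
  contractible gauge-invariant observables to themselves up to sign; only odd tori (the statement's
  `2S+1`) see a frustrated seam. A negative-`β` witness would therefore have to come from `G ∌ -1`
  (SU(3)) or from global odd-torus effects surviving `S → ∞` — not computable here. Recommendation stands
  (planners): add `sch.HasWeakCouplingLimit →` (free for `closes`).

Dead ends (one line each): trivial `G` (conclusion provable, §2); `β ≡ 0` any `G` (finite-range lattice
correlations ⇒ white noise/constants, invisible on `⁰𝒮` ⇒ conclusion holds); Coulomb-phase `U(1)` at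
fixed `β` (power-law lattice decay violates `HasLatticeMassGap` because `S`, hence `n`, is unbounded at
each `k`); `r.N = 0` (forces `G` trivial); junk freedom in `T` off the product tensors (none: `T` is
pinned on `⁰𝒮` by continuity + density of separated real product tensors, tree
`hasMassGap_of_csBound_span`); truncating a Schwinger family at degree 2 to fake a gapless datum (E2 with
E1 forces `𝔖₂ = 0` on time-ordered tensors); mixtures of constant fields (gapless but violate E4).

`lean check`: rc 0, 0 sorries. Namespace `Summit.QuantumFields.YangMills.Cruxes.GapToContinuum.Disproof`.
-/

noncomputable section

open scoped SchwartzMap ComplexConjugate BigOperators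
open MeasureTheory Filter Topology Complex
open Literature.MathematicalPhysics.AQFT Literature.MathematicalPhysics.QuantumLattice
open Literature.MathematicalPhysics.QuantumFieldTheory Literature.Probability.LatticeModels

namespace Summit.QuantumFields.YangMills.Cruxes.GapToContinuum.Disproof

open Summit.QuantumFields.YangMills.Theses.LangevinControlUV

/-! ## §1 Reading of the crux -/

/-- The crux, unfolded: note the ABSENT hypotheses (`IsCompactSimpleLieGroup G`, `0 ≤ sch.β k`,
`sch.HasWeakCouplingLimit`) and the quantifier shape of `HasLatticeMassGap`
(`∀ A B, ∃ C, ∀ᶠ k, ∀ S ≥ L_k, ∀ n ≤ S`). [folklore] -/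
theorem gapToContinuum_iff :
    GapToContinuum ↔
      ∀ (G : Type) [Group G] [TopologicalSpace G] [IsTopologicalGroup G] [CompactSpace G]
        [MeasurableSpace G] [BorelSpace G] (r : LatticeRep G) (sch : SpeciesScheme (YMSpecies G))
        (T : OSData (YMSpecies G) 4) (Δ : ℝ), 0 < Δ → IsYangMillsFor r sch T →
        (∀ A B : YMSpecies G, ∃ C : ℝ, ∀ᶠ k in atTop, ∀ S : ℕ, sch.L k ≤ S → ∀ n : ℕ, n ≤ S →
          |latticeConnectedCorr r.ρ (sch.β k) (2 * S + 1) A.F B.F n| ≤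
            C * Real.exp (-(Δ * (sch.a k * n)))) →
        T.schwinger.HasMassGap Δ :=
  Iff.rfl

/-! ## §2 Junk audit: the trivial gauge group satisfies the crux (from `IsYangMillsFor` alone) -/

section Subsingleton

variable {G : Type} [Group G] [TopologicalSpace G] [IsTopologicalGroup G] [CompactSpace G]
  [MeasurableSpace G] [BorelSpace G]

/-- At a trivial (subsingleton) gauge group the lattice `n`-point functions are DETERMINISTIC products of
the smeared constant fields. [folklore] -/
theorem latticeSchwinger_of_subsingleton [Subsingleton G] (r : LatticeRep G)
    (sch : SpeciesScheme (YMSpecies G)) (k n : ℕ) (σ : Fin n → YMSpecies G)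
    (f : Fin n → 𝓢(EuclideanSpace ℝ (Fin 4), ℝ)) :
    latticeSchwinger r.ρ sch (fun s => s.F) k n σ f =
      ∏ i, smearedLatticeField (σ i).F (box 4 (sch.L k)) (sch.a k) (sch.c (σ i) k) (sch.m (σ i) k)
        (f i) 1 := by
  haveI := isProbabilityMeasure_wilsonMeasure (d := 4) (L := sch.side k) r.ρ r.continuous (sch.β k)
  unfold latticeSchwinger
  have h : (fun U : GaugeConfig 4 (sch.side k) G => ∏ i, smearedLatticeField (σ i).F (box 4 (sch.L k))
      (sch.a k) (sch.c (σ i) k) (sch.m (σ i) k) (f i) (torusLift (sch.side k) U)) = fun _ =>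
      ∏ i, smearedLatticeField (σ i).F (box 4 (sch.L k)) (sch.a k) (sch.c (σ i) k) (sch.m (σ i) k)
        (f i) 1 :=
    funext fun U => by rw [Subsingleton.elim (torusLift (sch.side k) U) 1]
  rw [h, integral_const, smul_eq_mul, probReal_univ, one_mul]

/-- Hence they are MULTIPLICATIVE under appending species strings. [folklore] -/
theorem latticeSchwinger_append_of_subsingleton [Subsingleton G] (r : LatticeRep G)
    (sch : SpeciesScheme (YMSpecies G)) (k n m : ℕ) (σ : Fin n → YMSpecies G) (σ' : Fin m → YMSpecies G)
    (f : Fin n → 𝓢(EuclideanSpace ℝ (Fin 4), ℝ)) (g : Fin m → 𝓢(EuclideanSpace ℝ (Fin 4), ℝ)) :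
    latticeSchwinger r.ρ sch (fun s => s.F) k (n + m) (Fin.append σ σ') (Fin.append f g) =
      latticeSchwinger r.ρ sch (fun s => s.F) k n σ f * latticeSchwinger r.ρ sch (fun s => s.F) k m σ' g := by
  simp only [latticeSchwinger_of_subsingleton, Fin.prod_univ_add, Fin.append_left, Fin.append_right]

/-- **At a trivial gauge group `IsYangMillsFor` alone gives the tree's Cauchy–Schwarz clustering at
EVERY rate**: the clustered combination `Σ c̄ᵢ c'ⱼ (Λ(θpᵢ ++ T_t qⱼ) − Λ(θpᵢ) Λ(qⱼ))` equals
`Σ c̄ᵢ c'ⱼ Λ(θpᵢ) (Λ(T_t qⱼ) − Λ(qⱼ))`, and `Λ(T_t qⱼ) − Λ(qⱼ) → 𝔖(T_t Qⱼ) − 𝔖(Qⱼ) = 0` by E1.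
[folklore] -/
theorem hasCSClustering_of_subsingleton [Subsingleton G] (r : LatticeRep G)
    (sch : SpeciesScheme (YMSpecies G)) {T : OSData (YMSpecies G) 4} (hYM : IsYangMillsFor r sch T)
    (Δ : ℝ) : sch.HasCSClustering r Δ := by
  intro n m hn hm σ σ' N N' c c' p q hp hq t ht ε hε
  have hP : ∀ i, ∃ P : 𝓢((Fin n → EuclideanSpace ℝ (Fin 4)), ℂ),
      IsTensorOf P (fun l => ofRealTest (p i l)) := fun i => exists_isTensorOf _
  have hQ : ∀ j, ∃ Q : 𝓢((Fin m → EuclideanSpace ℝ (Fin 4)), ℂ),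
      IsTensorOf Q (fun l => ofRealTest (q j l)) := fun j => exists_isTensorOf _
  choose P hpT using hP
  choose Q hqT using hQ
  have hPi : ∀ i, IsTimeOrdered (P i) := fun i =>
    IsTimeOrdered.of_mem_slabOrderedProducts ((hp i).mem_slabOrderedProducts (hpT i))
  have hQj : ∀ j, IsTimeOrdered (Q j) := fun j =>
    IsTimeOrdered.of_mem_slabOrderedProducts ((hq j).mem_slabOrderedProducts (hqT j))
  set a : EuclideanSpace ℝ (Fin 4) := EuclideanSpace.single 0 t with ha
  set Λ : ℕ → (n : ℕ) → (Fin n → YMSpecies G) → (Fin n → 𝓢(EuclideanSpace ℝ (Fin 4), ℝ)) → ℂ :=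
    fun k n σ f => ((latticeSchwinger r.ρ sch (fun s => s.F) k n σ f : ℝ) : ℂ) with hΛ
  have hB : ∀ i, Tendsto (fun k => Λ k n (σ ∘ Fin.rev) (fun l => thetaTest 4 (p i (Fin.rev l))))
      atTop (𝓝 (T.schwinger n (σ ∘ Fin.rev) (osAdjoint (P i)))) :=
    fun i => hYM n hn _ _ _ (hpT i).osAdjoint (hPi i).isOffDiagonal.osAdjoint
  have hC : ∀ j, Tendsto (fun k => Λ k m σ' (q j)) atTop (𝓝 (T.schwinger m σ' (Q j))) :=
    fun j => hYM m hm _ _ _ (hqT j) (hQj j).isOffDiagonal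
  have hC' : ∀ j, Tendsto (fun k => Λ k m σ' (fun l => translateTest a (q j l))) atTop
      (𝓝 (T.schwinger m σ' (Q j))) := by
    intro j
    have ha0 : 0 ≤ a 0 := by simp [ha, ht]
    have h1 := hYM m hm σ' (fun l => translateTest a (q j l)) (translateMulti a (Q j))
      ((hqT j).translateMulti a)
      (OSReconstructionNoE1.isTimeOrdered_translateMulti (hQj j) ha0).isOffDiagonal
    rwa [T.invariant.1 m σ' a (Q j) (hQj j).isOffDiagonal] at h1
  have hterm : ∀ i j, Tendsto (fun k =>
      Λ k (n + m) (Fin.append (σ ∘ Fin.rev) σ')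
          (Fin.append (fun l => thetaTest 4 (p i (Fin.rev l))) (fun l => translateTest a (q j l))) -
        Λ k n (σ ∘ Fin.rev) (fun l => thetaTest 4 (p i (Fin.rev l))) * Λ k m σ' (q j))
      atTop (𝓝 0) := by
    intro i j
    have heq : ∀ k, Λ k (n + m) (Fin.append (σ ∘ Fin.rev) σ')
        (Fin.append (fun l => thetaTest 4 (p i (Fin.rev l))) (fun l => translateTest a (q j l))) =
        Λ k n (σ ∘ Fin.rev) (fun l => thetaTest 4 (p i (Fin.rev l))) *
          Λ k m σ' (fun l => translateTest a (q j l)) := fun k => by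
      simp only [hΛ]
      rw [latticeSchwinger_append_of_subsingleton]
      push_cast
      ring
    simp_rw [heq, ← mul_sub]
    have := (hB i).mul ((hC' j).sub (hC j))
    simpa using this
  have hsum : Tendsto (fun k => ∑ i, ∑ j, conj (c i) * c' j *
      (Λ k (n + m) (Fin.append (σ ∘ Fin.rev) σ')
          (Fin.append (fun l => thetaTest 4 (p i (Fin.rev l))) (fun l => translateTest a (q j l))) -
        Λ k n (σ ∘ Fin.rev) (fun l => thetaTest 4 (p i (Fin.rev l))) * Λ k m σ' (q j)))
      atTop (𝓝 0) := by
    have := tendsto_finsetSum (Finset.univ : Finset (Fin N)) fun i _ =>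
      tendsto_finsetSum (Finset.univ : Finset (Fin N')) fun j _ =>
        (hterm i j).const_mul (conj (c i) * c' j)
    simpa using this
  have hnorm := hsum.norm
  rw [norm_zero] at hnorm
  have hev := hnorm.eventually (gt_mem_nhds hε)
  refine hev.mono fun k hk => ?_
  refine (le_of_lt hk).trans ?_
  have h0 : 0 ≤ Real.exp (-Δ * t) *
      Real.sqrt ‖∑ i, ∑ i', conj (c i) * c i' *
        Λ k (n + n) (Fin.append (σ ∘ Fin.rev) σ)
          (Fin.append (fun l => thetaTest 4 (p i (Fin.rev l))) (p i'))‖ *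
      Real.sqrt ‖∑ j, ∑ j', conj (c' j) * c' j' *
        Λ k (m + m) (Fin.append (σ' ∘ Fin.rev) σ')
          (Fin.append (fun l => thetaTest 4 (q j (Fin.rev l))) (q j'))‖ := by positivity
  linarith

/-- **Junk audit, conclusion: the crux HOLDS at every trivial gauge group, from `IsYangMillsFor` alone and
for every real `Δ`** — no degenerate-group instance can refute it, and there `0 < Δ` and
`HasLatticeMassGap` are idle. (Positive special case; recorded for the provers, not landed by the
disprover.) [folklore] -/
theorem gapToContinuum_of_subsingleton [Subsingleton G] (r : LatticeRep G)
    (sch : SpeciesScheme (YMSpecies G)) (T : OSData (YMSpecies G) 4) (hYM : IsYangMillsFor r sch T)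
    (Δ : ℝ) : T.HasMassGap Δ :=
  hYM.hasMassGap_of_hasCSClustering (hasCSClustering_of_subsingleton r sch hYM Δ)

/-- **The hypotheses are junk-reachable at every `G`**: the zero-coupling scheme and the vacuum-only datum
satisfy `IsYangMillsFor ∧ HasLatticeMassGap Δ` for every `Δ` (tree: `isYangMillsFor_vacuum`,
`hasLatticeMassGap_of_zero_coupling`); the conclusion also holds there (`OSData.vacuum_hasMassGap`).
[folklore] -/
theorem hypotheses_junk_reachable (r : LatticeRep G) (Δ : ℝ) :
    IsYangMillsFor r (SpeciesScheme.zero _) (OSData.vacuum (YMSpecies G) 4) ∧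
      HasLatticeMassGap r (SpeciesScheme.zero (YMSpecies G)) Δ ∧
      (OSData.vacuum (YMSpecies G) 4).HasMassGap Δ :=
  ⟨isYangMillsFor_vacuum r,
    Summit.QuantumFields.YangMills.Theorems.LatticeGapOnTrajectory.Negative.hasLatticeMassGap_of_zero_coupling
      r _ (fun _ => rfl) Δ,
    OSData.vacuum_hasMassGap Δ⟩

end Subsingleton

/-! ## §3 Load-bearing hypotheses -/

/-- The crux with `IsYangMillsFor` DROPPED. [folklore] -/
def GapToContinuumWithoutIsYangMillsFor : Prop :=
  ∀ (G : Type) [Group G] [TopologicalSpace G] [IsTopologicalGroup G] [CompactSpace G]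
    [MeasurableSpace G] [BorelSpace G] (r : LatticeRep G) (sch : SpeciesScheme (YMSpecies G))
    (T : OSData (YMSpecies G) 4) (Δ : ℝ), 0 < Δ → HasLatticeMassGap r sch Δ → T.HasMassGap Δ

/-- **H (not constructible in the tree today): a one-field OS datum on `ℝ⁴` WITHOUT mass gap at some
`Δ > 0`.** True in mathematics (the free scalar field of mass `0 < m < Δ`, or the massless free field);
in the tree free-field existence is the named fact `existsUnique_freeField`, its OS package is the
measure-form `IsFreeField.isOSMeasure`, and no LOWER bound on its clustering is held, so no inhabitant
of `OSData Unit 4` other than gap-trivial ones (`vacuum`, junk families) is available. [folklore] -/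
def GaplessOSDatum : Prop :=
  ∃ (T : OSData Unit 4) (Δ : ℝ), 0 < Δ ∧ ¬ T.HasMassGap Δ

/-- The trivial lattice representation of the trivial group. [folklore] -/
def unitRep : LatticeRep Unit where
  N := 1
  ρ := 1
  continuous := continuous_const
  injective := fun a b _ => Subsingleton.elim a b
  mem_unitary := fun _ => Submonoid.one_mem _

/-- **`IsYangMillsFor` is load-bearing (modulo H)** — LANDED verbatim (def-free form) as
`Theorems/GapToContinuum/Negative/WithoutIsYangMillsFor.lean` (p120966): given a gapless one-field OS
datum, relabel it over `YMSpecies Unit` (every species reads the same field; tree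
`OSData.exists_extendByZero`), take the trivial group at zero coupling (`HasLatticeMassGap` for every `Δ`,
tree `hasLatticeMassGap_of_zero_coupling`): the crux without `IsYangMillsFor` fails. [folklore] -/
theorem gapToContinuum_false_without_isYangMillsFor_of_gapless (h : GaplessOSDatum) :
    ¬ GapToContinuumWithoutIsYangMillsFor := by
  obtain ⟨T₀, Δ, hΔ, hgap⟩ := h
  intro hcrux
  obtain ⟨T, hlive, -⟩ :=
    OSData.exists_extendByZero (ι := YMSpecies Unit) T₀ (fun _ => ()) (fun _ => True)
  have hT : T.HasMassGap Δ :=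
    hcrux Unit unitRep (SpeciesScheme.zero _) T Δ hΔ
      (Summit.QuantumFields.YangMills.Theorems.LatticeGapOnTrajectory.Negative.hasLatticeMassGap_of_zero_coupling
        unitRep _ (fun _ => rfl) Δ)
  apply hgap
  have hres := LabelledSchwingerFamily.HasMassGap.restrict (S := T.schwinger) hT
    (fun _ : Unit => unitRep.curvature)
  have heq : (fun n (k : Fin n → Unit) => T.schwinger n ((fun _ : Unit => unitRep.curvature) ∘ k)) =
      T₀.schwinger := by
    funext n k
    rw [hlive n _ (fun _ => trivial)]
    congr 1
  rw [heq] at hres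
  exact hres

/-- The crux with `HasLatticeMassGap` DROPPED. STATUS: load-bearing modulo a GAPLESS CONTINUUM LIMIT OF
SOME WILSON LATTICE GAUGE THEORY (`∃ G r sch T Δ>0, IsYangMillsFor r sch T ∧ ¬ T.HasMassGap Δ`), e.g.
the free-photon scaling limit of compact `U(1)` at fixed `β` in the Coulomb phase (power-law
correlations: Guth 1980, Fröhlich–Spencer 1982 prove deconfinement bounds, not the full scaling limit)
— research-level, not attempted; recorded so that nobody mistakes the hypothesis for decoration.
[folklore] -/
def GapToContinuumWithoutLatticeGap : Prop :=
  ∀ (G : Type) [Group G] [TopologicalSpace G] [IsTopologicalGroup G] [CompactSpace G]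
    [MeasurableSpace G] [BorelSpace G] (r : LatticeRep G) (sch : SpeciesScheme (YMSpecies G))
    (T : OSData (YMSpecies G) 4) (Δ : ℝ), 0 < Δ → IsYangMillsFor r sch T → T.HasMassGap Δ

/-- At a trivial group even the lattice-gap-free version holds (so a witness against
`GapToContinuumWithoutLatticeGap` needs a non-trivial `G` with a non-ultralocal continuum limit).
[folklore] -/
theorem gapToContinuumWithoutLatticeGap_of_subsingleton {G : Type} [Group G] [TopologicalSpace G]
    [IsTopologicalGroup G] [CompactSpace G] [MeasurableSpace G] [BorelSpace G] [Subsingleton G]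
    (r : LatticeRep G) (sch : SpeciesScheme (YMSpecies G)) (T : OSData (YMSpecies G) 4) (Δ : ℝ)
    (_hΔ : 0 < Δ) (hYM : IsYangMillsFor r sch T) : T.HasMassGap Δ :=
  gapToContinuum_of_subsingleton r sch T hYM Δ

/-! ### §3c `0 < Δ` is decoration (note)

For `Δ ≤ 0` the conclusion `T.HasMassGap Δ` asks `‖𝔖_{n+m}(ΘF* ⊗ T_tG) − 𝔖ₙ(ΘF*)𝔖ₘ(G)‖ ≤ C e^{|Δ| t}`,
which every OS datum satisfies with `C = ‖Ψ_F‖ ‖Ψ_G‖` (contraction semigroup of OS reconstruction,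
`‖e^{-tH}(1 - P_Ω)‖ ≤ 1`). So dropping `0 < Δ` changes nothing: the hypothesis is not load-bearing and a
prover may ignore it. (Not formalised here: the tree's transfer `hasMassGap_of_csBound_span` is stated for
the gapped Cauchy–Schwarz bound; the `Δ ≤ 0` case is a remark, not a target.) -/

/-! ## §4 Natural strengthening refuted (LANDED p120725, `Negative/HeavyProductLeak.lean`)

`not_heavyKetsProductClosed`: for symmetric positive-semidefinite contractions `T` fixing a unit vacuum
`Ω` and symmetric observables `A`, clustering of `AΩ` at rate `q` does NOT give clustering of the sandwich
kets `A Tˢ A Ω` (witness `T = diag(1, 1/4, 1/2)`, `A` coupling vacuum ↔ heavy ↔ light: connected function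
of `A Tˢ A Ω` is `16⁻ˢ 2⁻ᵗ`, every `s`). Reading for the crux: `HasLatticeMassGap`'s per-pair thresholds
give the `(1,1)` sector of `T.HasMassGap` (with RP, `0 ≤ β`), never the multi-leg sectors, whose lattice
approximants are sums over bilocal species `A · τ_z B` with `|z| ≲ s/a_k → ∞` distinct thresholds. -/

-- (landed modules `…Theorems.GapToContinuum.Negative.HeavyProductLeak` / `.WithoutIsYangMillsFor` are
-- deliberately NOT imported here, so that this work file elaborates against any tree snapshot.)

/-! ## §5 The β-sign hole: why negative coupling gives no cheap witness for `G ∋ -1` -/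

/-- The staggering exponent `f_ν(x) = Σ_{μ < ν} x_μ` on `ℤ^d`. [folklore] -/
def stagger {d : ℕ} (ν : Fin d) (x : Fin d → ℤ) : ℤ :=
  ∑ μ ∈ Finset.univ.filter (· < ν), x μ

/-- Shifting `x` in direction `κ` changes `f_ν` by `[κ < ν]`. [folklore] -/
theorem stagger_add_single {d : ℕ} (ν κ : Fin d) (x : Fin d → ℤ) :
    stagger ν (x + Pi.single κ 1) = stagger ν x + if κ < ν then 1 else 0 := by
  unfold stagger
  simp only [Pi.add_apply, Finset.sum_add_distrib]
  congr 1
  rw [Finset.sum_filter]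
  have h : ∀ μ : Fin d, (if μ < ν then (Pi.single κ (1 : ℤ) : Fin d → ℤ) μ else 0) =
      if μ = κ then (if κ < ν then 1 else 0) else 0 := by
    intro μ
    by_cases hμ : μ = κ
    · subst hμ; simp
    · simp [hμ]
  simp_rw [h]
  rw [Finset.sum_ite_eq' Finset.univ κ]
  simp

/-- **Every plaquette carries an ODD number of staggered links** (all dimensions): the plaquette
`(x; μ, ν)`, `μ < ν`, consists of the links `(x, μ)`, `(x + e_μ, ν)`, `(x + e_ν, μ)`, `(x, ν)`, and
`f_μ(x) + f_ν(x + e_μ) + f_μ(x + e_ν) + f_ν(x) = 2 f_μ(x) + 2 f_ν(x) + 1`. Hence `U_e ↦ (-1)^{f(e)} U_e`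
flips every plaquette variable `U_p ↦ -U_p` for `G ∋ -1` central (U(1), SU(2)): Wilson's weight at `β`
becomes the weight at `-β`, Haar measure is preserved, and contractible gauge-invariant observables (even
number of links in each direction) are mapped to themselves up to a computable sign — on `ℤ^d` and on EVEN
tori. On the ODD tori `2S+1` of the crux the parity `x_μ mod 2` is ill-defined: `β < 0` differs from
`β > 0` only through a frustrated seam winding around the torus. [folklore] -/
theorem stagger_plaquette_odd {d : ℕ} (x : Fin d → ℤ) {μ ν : Fin d} (hμν : μ < ν) :
    Odd (stagger μ x + stagger ν (x + Pi.single μ 1) + stagger μ (x + Pi.single ν 1) + stagger ν x) := by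
  rw [stagger_add_single, stagger_add_single, if_pos hμν, if_neg (not_lt.2 hμν.le)]
  exact ⟨stagger μ x + stagger ν x, by ring⟩

end Summit.QuantumFields.YangMills.Cruxes.GapToContinuum.Disproof

end
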